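import Summits.QuantumFields.BalabanUV.Beta.D1BFx.RestKernelFPUnit
import Summits.QuantumFields.BalabanUV.Beta.D1BFx.RestKernelSandwichSlot

/-!
# `BalabanUV.Beta.D1BFx.RestKernelFPSlot` — road «BF-x» for binder row D1, slot (K): **«FP SLOT PACK» — THE COMB-FP WORD OF THE (K6c) SKELETON
# AS ONE MEMBER FAMILY `RkFP 𝓻 𝓌 : Unit → ℕ → …` OF THE (K) SLOT, GENERIC IN THE PER-SCALE ROOT AND FIRST-WEIGHT FAMILY, WITH ITS POINTWISE SUM
# (= PART 8's `2·hessKer idK1 𝒳 𝒳₂` WORD VERBATIM), ITS `hMR` ∕ `hRu` ∕ `hU` ROWS ON THE DISPLAYED COLUMN-ENVELOPE LETTER, AND ITS n-FREE `hU₁` FRAGMENT** —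
# the `Unit`-indexed twin of «SANDWICH SLOT PACK» `RestKernelSandwichSlot` (p324769 ✓) over leaf-04 g20's «RK-FP UNIT» `RestKernelFPUnit`
# v1.2 (`decay510_fpWord`, `Kfp_le_units` with the comb-gauge sup `Λ` displayed; OWNER W-d1p2-g18-14's located currency, here the DISPLAYED units letter `Λ n·Cw n·n⁴ ≤ cw`).

HONEST DEPENDENCY (cell records, verbatim): «continuum YM on T⁴ ⇐ BetaPertH ∧ nine spine estimates (0/9 proved); BetaPertH ⇐ (D1) ∧ (D4) ∧
CAP+tail; G-an2-4 gates asym, D1 and NE2/3/4.»  HONEST FRAMING (cell contract, verbatim): «discharging `BetaPertH` makes Bałaban's UV stability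
UNCONDITIONAL — a real constructive-QFT result; it is NOT the continuum limit and NOT the Clay problem.»  THIS MODULE DISCHARGES NOTHING of the
wall: [folklore] pattern-matching ∕ `Fintype.sum_unique` bookkeeping + the (1.22) read-out of leaf-04's FP rows BY NAME, plus two [our object] DATA definitions
(`RkFP`, `CUfp`; asserting nothing).  The per-scale root `𝓻 n ∈ box 4 n`, the comb-gauge sup `|bmGaugeAt (toSite (𝓻 n)) (delta1 κ u) n x| ≤ Λ n`, the column
envelope `|𝓌 n κ′ v κ u| ≤ Cw n·e^{−(δ₀∕n)|u − n•v|₁}` (`Cw n ≤ Cw₀`) and the units line `Λ n·Cw n·n⁴ ≤ cw` are HYPOTHESES (displayed); at the road (`Λ n = 8n` today,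
`= 2` with «BMF-SHARP»; `Cw n = n⁻⁴·C_{G₀}` by gan24-leaf-05's «G0-COL-ENV») the units line is theirs ∕ leaf-04's to close — NOT claimed here.  No `def … : Prop`, no notation, nothing cited, 0 sorry.  0 root-level binders of row D1 discharged
(hW ∕ hR-sockets ∕ hSX-socket ∕ D1Tel ∕ D1Rep — 0); (K) NOT closed; NOT D1, NOT `BetaPertH`, NOT continuum, NOT Clay.

ABSOLUTE RULE (cell charter, verbatim): «No internally-minted statement may enter as a cited fact. Every hypothesis is either kernel-proved in
this package or a verbatim quotation of a PUBLISHED theorem with page reference. The manuscript(s) under audit are NOT citable for their own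
disputed steps — they are the thing under adjudication; programme-internal (2001/route/tribunal) claims are never citable.»

THE SHAPES (the (K1) END `RoadEndBFxDictPointwiseS.hdict_of_pointwise` at `υ := Unit`, `Rk := RkFP 𝓻 𝓌`): `hMR`; `hRu`; `hU₁`; `hU` (as in the sibling slot packs).
PART 8's word (at `n = m + 1`): `2 * hessKer idK1 (fun κ' v => fun x y c b => Σ_κ wsum (𝓌 n κ' v κ) (nFcol (𝓻 n) n κ) x y c b) (fun κ' v l v' => fun x y c b => Σ_κ wsum (𝓌 n κ' v κ)
(fun u => fun x y c b => 𝓌 n l v' κ u * nFcol (𝓻 n) n κ u x y c b) x y c b) μ ν z` with `𝓌 n := colH (coDressKBmAt (toSite r) n (KInvStep n 0)) n`, `𝓻 n := r` — the assembly's.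

CONTENT.
* §1 [our object] **`RkFP 𝓻 𝓌 u n μ ν z`** (pattern matching on `n`, `0` at the junk block size); `RkFP_zero` ∕ `RkFP_succ` (`rfl`).
* §2 [folklore] **`sum_RkFP_succ`** (`Σ_{u : Unit} RkFP 𝓻 𝓌 u (m+1) μ ν z` = the word; `Fintype.sum_unique`), the scale-`n` junction form `sum_RkFP_of_neZero`
  (`n ≥ 1`, the shape PART 10 prints at `n := Lc^m`), `sum_RkFP_zero`.
* §3 [our object] **`CUfp δ₀ cw Cw₀`** := `(4·(1 + 4∕δ₀)⁴·cw·Cw₀ + 16·e^{5δ₀}·(1 + 8∕δ₀)⁸·cw²)·Σ'_x |x|₁²·e^{−(δ₀∕2)|x|₁}` (n-free); `CUfp_nonneg`, `sum_CUfp` (the lane's `hU₁` fragment).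
* §4 [folklore] `Kfp_le_of_units` (leaf-04's `Kfp_le_units` + `Λ·C·n⁴ ≤ cw`, `C ≤ Cw₀` ⟹ `Kfp ≤ 4(1+4∕δ₀)⁴·cw·Cw₀ + 16e^{5δ₀}(1+8∕δ₀)⁸·cw²`); **`rows_RkFP`** (every `n ≥ 1`: `AbsMoment₂` ∧ `|secondMoment| ≤ CUfp δ₀ cw Cw₀`);
  **`END_rows_RkFP`** (the END's shapes at `n = Lc^m`: `hMR`, READING (b) `hRu`, READING (a) `hRu`∕`hU`, unit row).
NOT HERE (honest): the road's letters `Λ n`, `Cw n` (gan24-leaf-05's «G0-COL-ENV» ∕ «BMF-SHARP», leaf-04's §5∕§6); the other lanes; `hptw`; any statement about `TshotOf`.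
Unit `b2b-balaban-beta-d1-formalise-leaf-01` (gen 23), D1 formalisation swarm leaf prover 01, road «BF-x»; INTENT «FP SLOT PACK» (journal; leaf-04 g20 W-2 «GO leaf-01 — NOT MINE»).
-/

noncomputable section

open Finset
open scoped BigOperators
open Literature.MathematicalPhysics.QuantumFieldTheory.Balaban1983to89
open Literature.MathematicalPhysics.QuantumFieldTheory.Balaban1983to89.Beta
open B12Sec2to5 (l1 l1_nonneg Decay510 secondMoment_abs_le_of_decay510)
open DecimatedMomentSummable (AbsMoment₂ absMoment₂_of_decay510)
open ExpKernelCalculus (Site MKer hessKer Zl decay510_mono_const)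
open AffineAveraging (box toSite)
open KKTFluctuationKernel (delta1)
open Summit.QuantumFields.BalabanUV.Beta.AxialProjectorBlockMean (bmGaugeAt)
open OneStepResolventKernel (wsum)
open Summit.QuantumFields.BalabanUV.Beta.D1BFx.GaugeJetLocal (idK1)
open Summit.QuantumFields.BalabanUV.Beta.D1BFx.CombFPWordArrays (nFcol)
open Summit.QuantumFields.BalabanUV.Beta.D1BFx.RestKernelFPUnit (decay510_fpWord Kfp_le_units)
open Summit.QuantumFields.BalabanUV.Beta.D1BFx.RestKernelSandwichSlot (tsum_moment_nonneg)

namespace Summit.QuantumFields.BalabanUV.Beta.D1BFx.RestKernelFPSlot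

/-! ## §1 The FP member as a family TOTAL in the block size -/

/-- [our object] **THE COMB-FP FRAGMENT OF THE (K) SLOT**: `RkFP 𝓻 𝓌 u n μ ν z` := PART 8's comb-FP word `2·hessKer idK1 𝒳[𝓌 n, nFcol (𝓻 n) n] 𝒳₂[…] μ ν z`
at `n = m + 1` (per-scale root `𝓻 n` and first-weight family `𝓌 n` — generic; the assembly's) and `0` at the junk block size `n = 0` — pattern matching on `n`
(`nFcol r n` carries `[NeZero n]`), TOTAL in `n` as the END's `Rk : υ → ℕ → …` requires.  A DEFINITION; asserts nothing. -/
def RkFP (𝓻 : ℕ → Fin (3 + 1) → ℕ) (𝓌 : ℕ → Fin 4 → (Fin 4 → ℤ) → Fin 4 → (Fin 4 → ℤ) → ℝ) (_u : Unit) : ℕ → Fin 4 → Fin 4 → Site 4 → ℝ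
  | 0 => fun _ _ _ => 0
  | m + 1 => fun μ ν z => 2 * hessKer idK1
      (fun κ' v => fun x y c b => ∑ κ : Fin 4, wsum (𝓌 (m + 1) κ' v κ) (nFcol (𝓻 (m + 1)) (m + 1) κ) x y c b)
      (fun κ' v l v' => fun x y c b => ∑ κ : Fin 4,
        wsum (𝓌 (m + 1) κ' v κ) (fun u => fun x y c b => 𝓌 (m + 1) l v' κ u * nFcol (𝓻 (m + 1)) (m + 1) κ u x y c b) x y c b) μ ν z

variable (𝓻 : ℕ → Fin (3 + 1) → ℕ) (𝓌 : ℕ → Fin 4 → (Fin 4 → ℤ) → Fin 4 → (Fin 4 → ℤ) → ℝ)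

/-- [our object] The junk value: at `n = 0` the member is the zero kernel. -/
theorem RkFP_zero (u : Unit) : RkFP 𝓻 𝓌 u 0 = fun _ _ _ => 0 := rfl

/-- [our object] **AT `n = m + 1` THE MEMBER IS PART 8's COMB-FP WORD** at `𝓌 (m+1)`, `𝓻 (m+1)` (`rfl`). -/
theorem RkFP_succ (u : Unit) (m : ℕ) :
    RkFP 𝓻 𝓌 u (m + 1) = fun μ ν z => 2 * hessKer idK1
      (fun κ' v => fun x y c b => ∑ κ : Fin 4, wsum (𝓌 (m + 1) κ' v κ) (nFcol (𝓻 (m + 1)) (m + 1) κ) x y c b)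
      (fun κ' v l v' => fun x y c b => ∑ κ : Fin 4,
        wsum (𝓌 (m + 1) κ' v κ) (fun u => fun x y c b => 𝓌 (m + 1) l v' κ u * nFcol (𝓻 (m + 1)) (m + 1) κ u x y c b) x y c b) μ ν z := rfl

/-! ## §2 The pointwise sum: PART 8's comb-FP word -/

/-- [folklore] **THE FP LANE's CONTRIBUTION TO `Σ_u Rk u (m+1) μ ν z` IS THE COMB-FP WORD** (`Fintype.sum_unique` over `Unit`). -/
theorem sum_RkFP_succ (m : ℕ) (μ ν : Fin 4) (z : Site 4) :
    ∑ u : Unit, RkFP 𝓻 𝓌 u (m + 1) μ ν z = 2 * hessKer idK1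
      (fun κ' v => fun x y c b => ∑ κ : Fin 4, wsum (𝓌 (m + 1) κ' v κ) (nFcol (𝓻 (m + 1)) (m + 1) κ) x y c b)
      (fun κ' v l v' => fun x y c b => ∑ κ : Fin 4,
        wsum (𝓌 (m + 1) κ' v κ) (fun u => fun x y c b => 𝓌 (m + 1) l v' κ u * nFcol (𝓻 (m + 1)) (m + 1) κ u x y c b) x y c b) μ ν z := by
  rw [Fintype.sum_unique]
  rfl

/-- [folklore] **THE COMB-FP LANE's SUM AT ANY SCALE `n ≥ 1`, IN THE SHAPE PART 10 PRINTS** (`PackedRoadHptwScales.hptw_of_junctions` at `n := Lc^m`, with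
`𝓌 n := colH (coDressKBmAt (toSite (r n)) n (KInvStep n 0)) n`, `𝓻 := r`) — `sum_RkFP_succ` at `n = k + 1` (the `[NeZero n]` instance inside `nFcol` is a proof of a
`Prop`, so the two spellings agree by `rfl`). -/
theorem sum_RkFP_of_neZero (n : ℕ) [NeZero n] (μ ν : Fin 4) (z : Site 4) :
    ∑ u : Unit, RkFP 𝓻 𝓌 u n μ ν z = 2 * hessKer idK1
      (fun κ' v => fun x y c b => ∑ κ : Fin 4, wsum (𝓌 n κ' v κ) (nFcol (𝓻 n) n κ) x y c b)
      (fun κ' v l v' => fun x y c b => ∑ κ : Fin 4,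
        wsum (𝓌 n κ' v κ) (fun u => fun x y c b => 𝓌 n l v' κ u * nFcol (𝓻 n) n κ u x y c b) x y c b) μ ν z := by
  obtain ⟨k, rfl⟩ := Nat.exists_eq_succ_of_ne_zero (NeZero.ne n)
  rw [sum_RkFP_succ]

/-- [folklore] … and at the junk block size it is `0`. -/
theorem sum_RkFP_zero (μ ν : Fin 4) (z : Site 4) : ∑ u : Unit, RkFP 𝓻 𝓌 u 0 μ ν z = 0 :=
  Finset.sum_eq_zero fun _ _ => rfl

/-! ## §3 The n-free read-out constant and the lane's `hU₁` fragment -/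

/-- [our object] **THE n-FREE READ-OUT CONSTANT OF THE FP MEMBER** in the coarse rate `δ₀`, the units letter `cw` (`Λ n·Cw n·n⁴ ≤ cw`) and the envelope cap `Cw₀`:
`(4·(1 + 4∕δ₀)⁴·cw·Cw₀ + 16·e^{5δ₀}·(1 + 8∕δ₀)⁸·cw²)·Σ'_x |x|₁²·e^{−(δ₀∕2)|x|₁}` (leaf-04's `Kfp_le_units` v1.2).  A DEFINITION of a real number; asserts nothing. -/
def CUfp (δ₀ cw Cw₀ : ℝ) : Unit → ℝ := fun _ =>
  (4 * (1 + 4 / δ₀) ^ 4 * cw * Cw₀ + 16 * Real.exp (5 * δ₀) * (1 + 8 / δ₀) ^ 8 * cw ^ 2) * ∑' x : Site 4, l1 x ^ 2 * Real.exp (-(δ₀ / 2) * l1 x)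

/-- [our object] Unfolding `CUfp`. -/
theorem CUfp_apply (δ₀ cw Cw₀ : ℝ) (u : Unit) :
    CUfp δ₀ cw Cw₀ u = (4 * (1 + 4 / δ₀) ^ 4 * cw * Cw₀ + 16 * Real.exp (5 * δ₀) * (1 + 8 / δ₀) ^ 8 * cw ^ 2)
      * ∑' x : Site 4, l1 x ^ 2 * Real.exp (-(δ₀ / 2) * l1 x) := rfl

/-- [folklore] The read-out constant is nonnegative (`0 < δ₀`, `0 ≤ cw`, `0 ≤ Cw₀`). -/
theorem CUfp_nonneg {δ₀ cw Cw₀ : ℝ} (hδ₀ : 0 < δ₀) (hcw : 0 ≤ cw) (hCw₀ : 0 ≤ Cw₀) (u : Unit) : 0 ≤ CUfp δ₀ cw Cw₀ u := by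
  rw [CUfp_apply]
  have : 0 ≤ 4 * (1 + 4 / δ₀) ^ 4 * cw * Cw₀ + 16 * Real.exp (5 * δ₀) * (1 + 8 / δ₀) ^ 8 * cw ^ 2 := by positivity
  exact mul_nonneg this (tsum_moment_nonneg _)

/-- [folklore] **THE LANE's `hU₁` FRAGMENT, EXACTLY** (one member). -/
theorem sum_CUfp (δ₀ cw Cw₀ : ℝ) :
    ∑ u : Unit, CUfp δ₀ cw Cw₀ u = (4 * (1 + 4 / δ₀) ^ 4 * cw * Cw₀ + 16 * Real.exp (5 * δ₀) * (1 + 8 / δ₀) ^ 8 * cw ^ 2)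
      * ∑' x : Site 4, l1 x ^ 2 * Real.exp (-(δ₀ / 2) * l1 x) := by
  rw [Fintype.sum_unique]
  rfl

/-! ## §4 The rows on the displayed column-envelope letter -/

section Rows

variable {𝓻 𝓌} {Λ Cw : ℕ → ℝ} {δ₀ cw Cw₀ : ℝ} {μ ν : Fin 4}

/-- [folklore] **THE UNITS LINE APPLIED**: at the coarse rate `δ₀∕n`, comb-gauge sup `Λ ≥ 0`, envelope `0 ≤ C ≤ Cw₀` with `Λ·C·n⁴ ≤ cw`, leaf-04's
constant `Kfp` (v1.2) is `≤ 4·(1 + 4∕δ₀)⁴·cw·Cw₀ + 16·e^{5δ₀}·(1 + 8∕δ₀)⁸·cw²` (`Kfp_le_units`, then `Λ·C²·n⁴ = (Λ·C·n⁴)·C ≤ cw·Cw₀`, `Λ²·C²·n⁸ = (Λ·C·n⁴)² ≤ cw²`). -/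
theorem Kfp_le_of_units (n : ℕ) [NeZero n] (hδ₀ : 0 < δ₀) {Λ' C : ℝ} (hΛ0 : 0 ≤ Λ') (hC : 0 ≤ C) (hCC : C ≤ Cw₀)
    (hunit : Λ' * C * (n : ℝ) ^ 4 ≤ cw) :
    4 * Λ' * C * C * Zl 4 (δ₀ / n / 2)
        + (4 * Λ' * C * Real.exp (δ₀ / n / 2 * (4 * n + 1))) * (4 * Λ' * C * Real.exp (δ₀ / n / 2 * (4 * n + 1)))
          * Zl 4 (δ₀ / n / 2 / 2) ^ 2
      ≤ 4 * (1 + 4 / δ₀) ^ 4 * cw * Cw₀ + 16 * Real.exp (5 * δ₀) * (1 + 8 / δ₀) ^ 8 * cw ^ 2 := by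
  have hP : 0 ≤ Λ' * C * (n : ℝ) ^ 4 := by positivity
  have hcw : 0 ≤ cw := hP.trans hunit
  have h1 : Λ' * C ^ 2 * (n : ℝ) ^ 4 ≤ cw * Cw₀ := by
    have := mul_le_mul hunit hCC hC hcw
    nlinarith
  have h2 : Λ' ^ 2 * C ^ 2 * (n : ℝ) ^ 8 ≤ cw ^ 2 := by
    have := mul_self_le_mul_self hP hunit
    nlinarith
  have hA : 0 ≤ 4 * (1 + 4 / δ₀) ^ 4 := by positivity
  have hB : 0 ≤ 16 * Real.exp (5 * δ₀) * (1 + 8 / δ₀) ^ 8 := by positivity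
  calc _ ≤ (4 * (1 + 4 / δ₀) ^ 4 * Λ' * C ^ 2) * (n : ℝ) ^ 4 + (16 * Real.exp (5 * δ₀) * (1 + 8 / δ₀) ^ 8 * Λ' ^ 2 * C ^ 2) * (n : ℝ) ^ 8 :=
        Kfp_le_units (n := n) hδ₀ hC hΛ0
    _ = 4 * (1 + 4 / δ₀) ^ 4 * (Λ' * C ^ 2 * (n : ℝ) ^ 4) + 16 * Real.exp (5 * δ₀) * (1 + 8 / δ₀) ^ 8 * (Λ' ^ 2 * C ^ 2 * (n : ℝ) ^ 8) := by ring
    _ ≤ 4 * (1 + 4 / δ₀) ^ 4 * (cw * Cw₀) + 16 * Real.exp (5 * δ₀) * (1 + 8 / δ₀) ^ 8 * cw ^ 2 :=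
        add_le_add (mul_le_mul_of_nonneg_left h1 hA) (mul_le_mul_of_nonneg_left h2 hB)
    _ = _ := by ring

/-- [folklore] **THE ROWS OF THE FP LANE, EVERY BLOCK SIZE `n ≥ 1`** on the DISPLAYED letters: per-scale roots in their blocks (`𝓻 (m+1) ∈ box 4 (m+1)`), the
comb-gauge sup `Λ (m+1) ≥ 0`, the per-scale column envelope `|𝓌 (m+1) κ′ v κ u| ≤ Cw (m+1)·e^{−(δ₀∕(m+1))|u − (m+1)•v|₁}` (`0 ≤ Cw (m+1) ≤ Cw₀`, coarse rate
`δ₀ > 0`) and the units line `Λ (m+1)·Cw (m+1)·(m+1)⁴ ≤ cw`: the member has an absolutely summable second moment and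
`|secondMoment (RkFP 𝓻 𝓌 u n) μ ν| ≤ CUfp δ₀ cw Cw₀ u` — leaf-04's `decay510_fpWord` v1.2 (rate `δ₀∕2`, n-free) read by (1.22), the constant through `Kfp_le_of_units`. -/
theorem rows_RkFP (hδ₀ : 0 < δ₀) (hr : ∀ m : ℕ, 𝓻 (m + 1) ∈ box (3 + 1) (m + 1))
    (hΛ0 : ∀ m : ℕ, 0 ≤ Λ (m + 1))
    (hΛ : ∀ (m : ℕ) (κ : Fin 4) (u x : Fin 4 → ℤ), |bmGaugeAt (toSite (𝓻 (m + 1))) (delta1 κ u) (m + 1) x| ≤ Λ (m + 1))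
    (hCw : ∀ m : ℕ, 0 ≤ Cw (m + 1)) (hCw₀ : ∀ m : ℕ, Cw (m + 1) ≤ Cw₀)
    (hw : ∀ (m : ℕ) (κ' : Fin 4) (v : Fin 4 → ℤ) (κ : Fin 4) (u : Fin 4 → ℤ),
      |𝓌 (m + 1) κ' v κ u| ≤ Cw (m + 1) * Real.exp (-(δ₀ / ((m + 1 : ℕ) : ℝ)) * l1 (u - ((m + 1 : ℕ) : ℤ) • v)))
    (hunits : ∀ m : ℕ, Λ (m + 1) * Cw (m + 1) * (((m + 1 : ℕ) : ℝ)) ^ 4 ≤ cw) :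
    ∀ (u : Unit) (n : ℕ), 1 ≤ n → AbsMoment₂ (RkFP 𝓻 𝓌 u n μ ν) ∧ |B12Beta.secondMoment (RkFP 𝓻 𝓌 u n) μ ν| ≤ CUfp δ₀ cw Cw₀ u := by
  intro u n hn
  obtain ⟨m, rfl⟩ : ∃ m, n = m + 1 := ⟨n - 1, (Nat.sub_add_cancel hn).symm⟩
  have hn0 : (0 : ℝ) < ((m + 1 : ℕ) : ℝ) := by exact_mod_cast Nat.succ_pos m
  have hδ : 0 < δ₀ / ((m + 1 : ℕ) : ℝ) := div_pos hδ₀ hn0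
  have hd0 := decay510_fpWord (n := m + 1) (hr m) (hΛ m) (hw m) hδ (hCw m) μ ν
  have e : δ₀ / ((m + 1 : ℕ) : ℝ) / 2 * ((m + 1 : ℕ) : ℝ) = δ₀ / 2 := by field_simp
  have hK := Kfp_le_of_units (δ₀ := δ₀) (cw := cw) (Cw₀ := Cw₀) (m + 1) hδ₀ (hΛ0 m) (hCw m) (hCw₀ m) (hunits m)
  have hd : Decay510 (RkFP 𝓻 𝓌 u (m + 1) μ ν)
      (4 * (1 + 4 / δ₀) ^ 4 * cw * Cw₀ + 16 * Real.exp (5 * δ₀) * (1 + 8 / δ₀) ^ 8 * cw ^ 2) (δ₀ / 2) := by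
    rw [RkFP_succ, ← e]
    exact decay510_mono_const hd0 hK
  have hδ2 : 0 < δ₀ / 2 := half_pos hδ₀
  refine ⟨absMoment₂_of_decay510 hδ2 hd, ?_⟩
  rw [CUfp_apply]
  exact (secondMoment_abs_le_of_decay510 (P := RkFP 𝓻 𝓌 u (m + 1)) hδ2 hd).2

/-- [folklore] **THE FP LANE's ROWS IN THE END's SHAPES** (`RoadEndBFxDictPointwiseS.hdict_of_pointwise` at `υ := Unit`, `Rk := RkFP 𝓻 𝓌`, any `[NeZero Lc]`):
(i) `hMR`; (ii) READING (b): `hRu` with `Ru := 0`, `CU′ := CUfp δ₀ cw Cw₀`; (iii) READING (a): `hRu` with `CU′ := 0` and `hU` with `CU := CUfp δ₀ cw Cw₀` at every `n ≥ 2`;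
(iv) the unit row at every `n ≥ 1`.  The `hU₁` fragment is `sum_CUfp`. -/
theorem END_rows_RkFP {Lc : ℕ} [NeZero Lc] (hδ₀ : 0 < δ₀) (hr : ∀ m : ℕ, 𝓻 (m + 1) ∈ box (3 + 1) (m + 1))
    (hΛ0 : ∀ m : ℕ, 0 ≤ Λ (m + 1))
    (hΛ : ∀ (m : ℕ) (κ : Fin 4) (u x : Fin 4 → ℤ), |bmGaugeAt (toSite (𝓻 (m + 1))) (delta1 κ u) (m + 1) x| ≤ Λ (m + 1))
    (hCw : ∀ m : ℕ, 0 ≤ Cw (m + 1)) (hCw₀ : ∀ m : ℕ, Cw (m + 1) ≤ Cw₀)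
    (hw : ∀ (m : ℕ) (κ' : Fin 4) (v : Fin 4 → ℤ) (κ : Fin 4) (u : Fin 4 → ℤ),
      |𝓌 (m + 1) κ' v κ u| ≤ Cw (m + 1) * Real.exp (-(δ₀ / ((m + 1 : ℕ) : ℝ)) * l1 (u - ((m + 1 : ℕ) : ℤ) • v)))
    (hunits : ∀ m : ℕ, Λ (m + 1) * Cw (m + 1) * (((m + 1 : ℕ) : ℝ)) ^ 4 ≤ cw) :
    -- (i) `hMR`
    (∀ (u : Unit) (m : ℕ), 1 ≤ m → AbsMoment₂ (RkFP 𝓻 𝓌 u (Lc ^ m) μ ν)) ∧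
    -- (ii) READING (b)
    (∀ (u : Unit) (m : ℕ), 1 ≤ m →
      |B12Beta.secondMoment (RkFP 𝓻 𝓌 u (Lc ^ m)) μ ν - (fun (_ : Unit) (_ : ℕ) => (0 : ℝ)) u (Lc ^ m)| ≤ CUfp δ₀ cw Cw₀ u) ∧
    -- (iii) READING (a)
    (∀ (u : Unit) (m : ℕ), 1 ≤ m →
      |B12Beta.secondMoment (RkFP 𝓻 𝓌 u (Lc ^ m)) μ ν - (fun (u : Unit) (n : ℕ) => B12Beta.secondMoment (RkFP 𝓻 𝓌 u n) μ ν) u (Lc ^ m)|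
        ≤ (fun _ : Unit => (0 : ℝ)) u) ∧
    (∀ n : ℕ, 2 ≤ n → ∀ u : Unit, |(fun (u : Unit) (n : ℕ) => B12Beta.secondMoment (RkFP 𝓻 𝓌 u n) μ ν) u n| ≤ CUfp δ₀ cw Cw₀ u) ∧
    -- (iv) the n-uniform unit row
    (∀ (u : Unit) (n : ℕ), 1 ≤ n → |B12Beta.secondMoment (RkFP 𝓻 𝓌 u n) μ ν| ≤ CUfp δ₀ cw Cw₀ u) := by
  have hrows := rows_RkFP (μ := μ) (ν := ν) hδ₀ hr hΛ0 hΛ hCw hCw₀ hw hunits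
  have hLm : ∀ m : ℕ, 1 ≤ Lc ^ m := fun m => Nat.one_le_pow _ _ (Nat.pos_of_ne_zero (NeZero.ne Lc))
  refine ⟨fun u m _ => (hrows u (Lc ^ m) (hLm m)).1, fun u m _ => ?_, fun u m _ => ?_, fun n hn u => ?_, fun u n hn => (hrows u n hn).2⟩
  · rw [sub_zero]
    exact (hrows u (Lc ^ m) (hLm m)).2
  · rw [sub_self, abs_zero]
  · exact (hrows u n ((Nat.le_succ 1).trans hn)).2

end Rows

end Summit.QuantumFields.BalabanUV.Beta.D1BFx.RestKernelFPSlot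

end
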